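import Literature.AnabelianGeometry.EtaleTheta.MonoThetaEnv
import Mathlib.Topology.Algebra.Group.Basic

/-!
# The dictionary `D ⊆ Aut(Π) ⊇ Inn(Π)` (bi-continuous) ↔ `D ⊆ Out(Π)` for topological groups

Bridge infrastructure for the abc-iut cell (layer L6 ↔ L2, MERGE-MAP §8 **B8**): [IUTchII] §1
(`Literature.IUT.HodgeArakelov.MonoThetaCyclotomes`, seat abc-iut-L6-t1) carries the datum
"`D_Π ⊆ Out(Π)`" of a mono-theta environment ([EtTh] Def. 2.13 (ii)) as a subgroup of `Aut(Π)` that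
contains the inner automorphisms and consists of bi-continuous automorphisms, while [EtTh] §2
(`Literature.AnabelianGeometry.EtaleTheta.MonoThetaEnv`, seat abc-iut-L2-t2) carries it as a subgroup of
`TopOut Π = contMulAut Π ⧸ innerContAut Π`. The two encodings are in canonical bijection (lattice
correspondence for the quotient map `contMulAut Π ↠ TopOut Π`, whose kernel is `Inn(Π)`); this file proves
that bijection (`autToOut` / `outToAut`) and its compatibility with transport along isomorphisms of
topological groups (`MulAut.congr e` on the `Aut` side, `TopOut.transport e` on the `Out` side), together
with the functoriality of `TopOut.transport` (`refl`, `trans`, `symm`) that [EtTh] Def. 2.13 (ii)'s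
"isomorphisms of mono-theta environments" need in order to be composed and inverted.

Pure topological group theory over Mathlib; nothing disputed is involved. Source of the two printed
phrasings: [cite: MochizukiEtTh2009, Def 2.13(ii) p.47] ("a subgroup `D_Π ⊆ Out(Π)`"; "any isomorphism
of topological groups `Π ≅ Π'` that maps `D_Π ↦ D_{Π'}`").
-/

namespace Literature.AnabelianGeometry.EtaleTheta

universe u

section Transport

variable {A B C : Type*} [Group A] [Group B] [Group C]
  [TopologicalSpace A] [TopologicalSpace B] [TopologicalSpace C]

/-- The underlying automorphism of `conjContAut e φ` is `e ∘ φ ∘ e⁻¹ = MulAut.congr e φ`.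
[cite: MochizukiEtTh2009, Def 2.13(ii) p.47] -/
@[simp] theorem coe_conjContAut (e : A ≃ₜ* B) (φ : contMulAut A) :
    ((conjContAut e φ : contMulAut B) : MulAut B) = MulAut.congr e.toMulEquiv (φ : MulAut A) := rfl

/-- `TopOut.transport e` on a class `[φ]` is the class of `e ∘ φ ∘ e⁻¹`.
[cite: MochizukiEtTh2009, Def 2.13(ii) p.47] -/
@[simp] theorem TopOut.transport_mk (e : A ≃ₜ* B) (φ : contMulAut A) :
    TopOut.transport e (TopOut.mk A φ) = TopOut.mk B (conjContAut e φ) := rfl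

/-- `conjContAut` along the identity is the identity. [cite: MochizukiEtTh2009, Def 2.13(ii) p.47] -/
theorem conjContAut_refl (φ : contMulAut A) :
    conjContAut (ContinuousMulEquiv.refl A) φ = φ := by
  apply Subtype.ext
  ext a
  rfl

/-- `conjContAut` along a composite is the composite. [cite: MochizukiEtTh2009, Def 2.13(ii) p.47] -/
theorem conjContAut_trans (e : A ≃ₜ* B) (f : B ≃ₜ* C) (φ : contMulAut A) :
    conjContAut (e.trans f) φ = conjContAut f (conjContAut e φ) := by
  apply Subtype.ext
  ext c
  rfl

/-- `conjContAut e.symm` is a left inverse of `conjContAut e`. [cite: MochizukiEtTh2009, Def 2.13(ii) p.47] -/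
theorem conjContAut_symm_apply (e : A ≃ₜ* B) (φ : contMulAut A) :
    conjContAut e.symm (conjContAut e φ) = φ := by
  apply Subtype.ext
  ext a
  change e.symm (e (φ.1 (e.symm (e a)))) = φ.1 a
  simp

/-- `conjContAut e` is a left inverse of `conjContAut e.symm`. [cite: MochizukiEtTh2009, Def 2.13(ii) p.47] -/
theorem conjContAut_apply_symm (e : A ≃ₜ* B) (ψ : contMulAut B) :
    conjContAut e (conjContAut e.symm ψ) = ψ := by
  apply Subtype.ext
  ext b
  change e (e.symm (ψ.1 (e (e.symm b)))) = ψ.1 b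
  simp

/-- Transport of outer automorphisms along the identity is the identity.
[cite: MochizukiEtTh2009, Def 2.13(ii) p.47] -/
theorem TopOut.transport_refl :
    TopOut.transport (ContinuousMulEquiv.refl A) = MonoidHom.id (TopOut A) := by
  refine QuotientGroup.monoidHom_ext _ (MonoidHom.ext fun φ => ?_)
  change TopOut.transport _ (TopOut.mk A φ) = TopOut.mk A φ
  rw [TopOut.transport_mk, conjContAut_refl]

/-- Transport of outer automorphisms is functorial in the isomorphism: `transport (e ≫ f) =
transport f ∘ transport e`. [cite: MochizukiEtTh2009, Def 2.13(ii) p.47] -/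
theorem TopOut.transport_trans (e : A ≃ₜ* B) (f : B ≃ₜ* C) :
    TopOut.transport (e.trans f) = (TopOut.transport f).comp (TopOut.transport e) := by
  refine QuotientGroup.monoidHom_ext _ (MonoidHom.ext fun φ => ?_)
  change TopOut.transport _ (TopOut.mk A φ) = TopOut.transport f (TopOut.transport e (TopOut.mk A φ))
  rw [TopOut.transport_mk, TopOut.transport_mk, TopOut.transport_mk, conjContAut_trans]

/-- `transport e.symm ∘ transport e = id`. [cite: MochizukiEtTh2009, Def 2.13(ii) p.47] -/
theorem TopOut.transport_symm_comp (e : A ≃ₜ* B) :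
    (TopOut.transport e.symm).comp (TopOut.transport e) = MonoidHom.id (TopOut A) := by
  refine QuotientGroup.monoidHom_ext _ (MonoidHom.ext fun φ => ?_)
  change TopOut.transport e.symm (TopOut.transport e (TopOut.mk A φ)) = TopOut.mk A φ
  rw [TopOut.transport_mk, TopOut.transport_mk, conjContAut_symm_apply]

/-- `transport e ∘ transport e.symm = id`. [cite: MochizukiEtTh2009, Def 2.13(ii) p.47] -/
theorem TopOut.transport_comp_symm (e : A ≃ₜ* B) :
    (TopOut.transport e).comp (TopOut.transport e.symm) = MonoidHom.id (TopOut B) := by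
  refine QuotientGroup.monoidHom_ext _ (MonoidHom.ext fun ψ => ?_)
  change TopOut.transport e (TopOut.transport e.symm (TopOut.mk B ψ)) = TopOut.mk B ψ
  rw [TopOut.transport_mk, TopOut.transport_mk, conjContAut_apply_symm]

/-- Transport of outer automorphisms along `e` as a group ISOMORPHISM `Out(A) ≃ Out(B)` (inverse:
transport along `e.symm`). [cite: MochizukiEtTh2009, Def 2.13(ii) p.47] -/
def TopOut.transportEquiv (e : A ≃ₜ* B) : TopOut A ≃* TopOut B :=
  (TopOut.transport e).toMulEquiv (TopOut.transport e.symm)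
    (TopOut.transport_symm_comp e) (TopOut.transport_comp_symm e)

/-- `TopOut.transportEquiv e` is `TopOut.transport e` as a function.
[cite: MochizukiEtTh2009, Def 2.13(ii) p.47] -/
@[simp] theorem TopOut.transportEquiv_apply (e : A ≃ₜ* B) (x : TopOut A) :
    TopOut.transportEquiv e x = TopOut.transport e x := rfl

/-- The inverse of `TopOut.transportEquiv e` is transport along `e.symm`.
[cite: MochizukiEtTh2009, Def 2.13(ii) p.47] -/
@[simp] theorem TopOut.transportEquiv_symm_apply (e : A ≃ₜ* B) (y : TopOut B) :
    (TopOut.transportEquiv e).symm y = TopOut.transport e.symm y := rfl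

/-- Subgroups mapped forth along `transport e` and back along `transport e.symm` return to themselves.
[cite: MochizukiEtTh2009, Def 2.13(ii) p.47] -/
theorem Subgroup_map_transport_symm_map_transport (e : A ≃ₜ* B) (E : Subgroup (TopOut A)) :
    (E.map (TopOut.transport e)).map (TopOut.transport e.symm) = E := by
  rw [Subgroup.map_map, TopOut.transport_symm_comp, Subgroup.map_id]

/-- A topological-group structure transfers backwards along an isomorphism of topological groups
(used to re-bundle the [EtTh]-side data, which carry only a topology, as the `TopGroup`s of [IUTchII] §1).
[cite: MochizukiEtTh2009, Def 2.13(ii) p.47] -/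
theorem isTopologicalGroup_of_continuousMulEquiv (e : A ≃ₜ* B) [IsTopologicalGroup B] :
    IsTopologicalGroup A :=
  e.toHomeomorph.isInducing.topologicalGroup e.toMulEquiv.toMonoidHom

end Transport

/-! ## The dictionary `Aut ⊇ Inn`-subgroups ↔ `Out`-subgroups -/

section Dictionary

variable (A : Type*) [Group A] [TopologicalSpace A]

/-- `D ⊆ Aut(A)` ↦ its image in `Out_top(A)`: intersect with the bi-continuous automorphisms, then project
modulo inner automorphisms. [cite: MochizukiEtTh2009, Def 2.13(ii) p.47] -/
def autToOut (D : Subgroup (MulAut A)) : Subgroup (TopOut A) :=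
  (D.subgroupOf (contMulAut A)).map (TopOut.mk A)

/-- `E ⊆ Out_top(A)` ↦ its full preimage in `Aut(A)` (a subgroup of bi-continuous automorphisms containing
the bi-continuous inner automorphisms). [cite: MochizukiEtTh2009, Def 2.13(ii) p.47] -/
def outToAut (E : Subgroup (TopOut A)) : Subgroup (MulAut A) :=
  (E.comap (TopOut.mk A)).map (contMulAut A).subtype

variable {A}

/-- Membership in `outToAut E`: bi-continuous with class in `E`. [cite: MochizukiEtTh2009, Def 2.13(ii) p.47] -/
theorem mem_outToAut_iff {E : Subgroup (TopOut A)} {φ : MulAut A} :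
    φ ∈ outToAut A E ↔ ∃ h : φ ∈ contMulAut A, TopOut.mk A ⟨φ, h⟩ ∈ E := by
  constructor
  · rintro ⟨ψ, hψ, rfl⟩
    exact ⟨ψ.2, hψ⟩
  · rintro ⟨h, hE⟩
    exact ⟨⟨φ, h⟩, hE, rfl⟩

/-- Membership in `autToOut D`: the class of a bi-continuous member of `D`.
[cite: MochizukiEtTh2009, Def 2.13(ii) p.47] -/
theorem mem_autToOut_iff {D : Subgroup (MulAut A)} {x : TopOut A} :
    x ∈ autToOut A D ↔ ∃ φ : contMulAut A, (φ : MulAut A) ∈ D ∧ TopOut.mk A φ = x := by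
  constructor
  · rintro ⟨φ, hφ, rfl⟩
    exact ⟨φ, hφ, rfl⟩
  · rintro ⟨φ, hφ, rfl⟩
    exact ⟨φ, hφ, rfl⟩

/-- The class of a bi-continuous member of `D` lies in `autToOut D`. [cite: MochizukiEtTh2009, Def 2.13(ii) p.47] -/
theorem mk_mem_autToOut {D : Subgroup (MulAut A)} (φ : contMulAut A) (hφ : (φ : MulAut A) ∈ D) :
    TopOut.mk A φ ∈ autToOut A D :=
  mem_autToOut_iff.2 ⟨φ, hφ, rfl⟩

/-- `outToAut E` consists of bi-continuous automorphisms. [cite: MochizukiEtTh2009, Def 2.13(ii) p.47] -/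
theorem outToAut_le_contMulAut (E : Subgroup (TopOut A)) : outToAut A E ≤ contMulAut A := by
  rintro _ ⟨ψ, -, rfl⟩
  exact ψ.2

/-- Members of `outToAut E` are homeomorphisms (the form in which [IUTchII] §1 records `Out` of a
TOPOLOGICAL group). [cite: MochizukiEtTh2009, Def 2.13(ii) p.47] -/
theorem continuous_of_mem_outToAut {E : Subgroup (TopOut A)} {φ : MulAut A} (h : φ ∈ outToAut A E) :
    Continuous φ ∧ Continuous φ.symm :=
  outToAut_le_contMulAut E h

/-- `outToAut E` contains the inner automorphisms. [cite: MochizukiEtTh2009, Def 2.13(ii) p.47] -/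
theorem innerAut_le_outToAut [IsTopologicalGroup A] (E : Subgroup (TopOut A)) :
    innerAut A ≤ outToAut A E := by
  intro φ hφ
  refine mem_outToAut_iff.2 ⟨innerAut_le_contMulAut A hφ, ?_⟩
  have h1 : TopOut.mk A ⟨φ, innerAut_le_contMulAut A hφ⟩ = 1 := by
    rw [← MonoidHom.mem_ker, QuotientGroup.ker_mk']
    exact hφ
  rw [h1]
  exact one_mem E

/-- `autToOut` is monotone. [cite: MochizukiEtTh2009, Def 2.13(ii) p.47] -/
theorem autToOut_mono {D D' : Subgroup (MulAut A)} (h : D ≤ D') : autToOut A D ≤ autToOut A D' :=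
  Subgroup.map_mono fun _ hφ => h hφ

/-- `outToAut` is monotone. [cite: MochizukiEtTh2009, Def 2.13(ii) p.47] -/
theorem outToAut_mono {E E' : Subgroup (TopOut A)} (h : E ≤ E') : outToAut A E ≤ outToAut A E' :=
  Subgroup.map_mono (Subgroup.comap_mono h)

/-- `Out → Aut → Out` is the identity on subgroups (the projection `contMulAut A ↠ TopOut A` is onto).
[cite: MochizukiEtTh2009, Def 2.13(ii) p.47] -/
theorem autToOut_outToAut (E : Subgroup (TopOut A)) : autToOut A (outToAut A E) = E := by
  have h1 : (outToAut A E).subgroupOf (contMulAut A) = E.comap (TopOut.mk A) := by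
    ext ψ
    rw [Subgroup.mem_subgroupOf, mem_outToAut_iff, Subgroup.mem_comap]
    constructor
    · rintro ⟨hc, h⟩
      exact h
    · intro h
      exact ⟨ψ.2, h⟩
  rw [autToOut, h1]
  exact Subgroup.map_comap_eq_self_of_surjective (QuotientGroup.mk'_surjective _) E

/-- `Aut → Out → Aut` is the identity on subgroups `D` with `Inn(A) ⊆ D ⊆ Aut_top(A)` (the kernel of the
projection is `Inn(A)`). [cite: MochizukiEtTh2009, Def 2.13(ii) p.47] -/
theorem outToAut_autToOut {D : Subgroup (MulAut A)} (hinn : innerAut A ≤ D) (hcont : D ≤ contMulAut A) :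
    outToAut A (autToOut A D) = D := by
  have hker : (TopOut.mk A).ker ≤ D.subgroupOf (contMulAut A) := by
    intro ψ hψ
    rw [QuotientGroup.ker_mk'] at hψ
    exact hinn hψ
  rw [outToAut, autToOut, Subgroup.comap_map_eq_self hker]
  ext φ
  constructor
  · rintro ⟨ψ, hψ, rfl⟩
    exact hψ
  · intro hφ
    exact ⟨⟨φ, hcont hφ⟩, hφ, rfl⟩

/-- The dictionary as an ORDER ISOMORPHISM between the subgroups `D` of `Aut(A)` with
`Inn(A) ⊆ D ⊆ Aut_top(A)` and the subgroups of `Out_top(A)`.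
[cite: MochizukiEtTh2009, Def 2.13(ii) p.47] -/
def autOutOrderIso [IsTopologicalGroup A] :
    {D : Subgroup (MulAut A) // innerAut A ≤ D ∧ D ≤ contMulAut A} ≃o Subgroup (TopOut A) where
  toFun D := autToOut A D.1
  invFun E := ⟨outToAut A E, innerAut_le_outToAut E, outToAut_le_contMulAut E⟩
  left_inv D := Subtype.ext (outToAut_autToOut D.2.1 D.2.2)
  right_inv E := autToOut_outToAut E
  map_rel_iff' := by
    intro D D'
    change autToOut A D.1 ≤ autToOut A D'.1 ↔ D.1 ≤ D'.1
    constructor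
    · intro h
      have h' := outToAut_mono (A := A) h
      rwa [outToAut_autToOut D.2.1 D.2.2, outToAut_autToOut D'.2.1 D'.2.2] at h'
    · exact fun h => autToOut_mono h

end Dictionary

/-! ## Compatibility with transport along isomorphisms of topological groups -/

section TransportDictionary

variable {A B : Type*} [Group A] [Group B] [TopologicalSpace A] [TopologicalSpace B]

/-- `MulAut.congr e` carries bi-continuous automorphisms to bi-continuous ones (subgroup form).
[cite: MochizukiEtTh2009, Def 2.13(ii) p.47] -/
theorem map_congr_contMulAut_le (e : A ≃ₜ* B) :
    (contMulAut A).map (MulAut.congr e.toMulEquiv).toMonoidHom ≤ contMulAut B := by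
  rintro _ ⟨φ, hφ, rfl⟩
  exact conjAut_mem_contMulAut e hφ

/-- **Transport compatibility, `Aut → Out`**: for `D ⊆ Aut_top(A)`, the `Out`-image of `e ∘ D ∘ e⁻¹` is
the transport along `e` of the `Out`-image of `D` — i.e. "maps `D_Π ↦ D_{Π'}`" means the same thing in
the two encodings. [cite: MochizukiEtTh2009, Def 2.13(ii) p.47] -/
theorem autToOut_map_congr (e : A ≃ₜ* B) {D : Subgroup (MulAut A)} (hD : D ≤ contMulAut A) :
    autToOut B (D.map (MulAut.congr e.toMulEquiv).toMonoidHom) =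
      (autToOut A D).map (TopOut.transport e) := by
  ext x
  constructor
  · intro hx
    obtain ⟨ψ, hψ, rfl⟩ := mem_autToOut_iff.1 hx
    obtain ⟨φ, hφ, hφψ⟩ := hψ
    have hφc : φ ∈ contMulAut A := hD hφ
    refine ⟨TopOut.mk A ⟨φ, hφc⟩, mk_mem_autToOut _ hφ, ?_⟩
    rw [TopOut.transport_mk]
    congr 1
    exact Subtype.ext hφψ
  · rintro ⟨y, hy, rfl⟩
    obtain ⟨φ, hφ, rfl⟩ := mem_autToOut_iff.1 hy
    rw [TopOut.transport_mk]
    exact mk_mem_autToOut _ ⟨φ, hφ, rfl⟩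

/-- **Transport compatibility, `Out → Aut`**: the `Aut`-preimage of the transported subgroup is
`e ∘ (preimage) ∘ e⁻¹`. [cite: MochizukiEtTh2009, Def 2.13(ii) p.47] -/
theorem outToAut_map_transport [IsTopologicalGroup A] [IsTopologicalGroup B] (e : A ≃ₜ* B)
    (E : Subgroup (TopOut A)) :
    outToAut B (E.map (TopOut.transport e)) =
      (outToAut A E).map (MulAut.congr e.toMulEquiv).toMonoidHom := by
  have h1 : autToOut B ((outToAut A E).map (MulAut.congr e.toMulEquiv).toMonoidHom) =
      E.map (TopOut.transport e) := by
    rw [autToOut_map_congr e (outToAut_le_contMulAut E), autToOut_outToAut]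
  have hinn : innerAut B ≤ (outToAut A E).map (MulAut.congr e.toMulEquiv).toMonoidHom := by
    rintro _ ⟨b, rfl⟩
    refine ⟨MulAut.conj (e.symm b), innerAut_le_outToAut E ⟨e.symm b, rfl⟩, ?_⟩
    change MulAut.congr e.toMulEquiv (MulAut.conj (e.symm b)) = MulAut.conj b
    rw [conjAut_conj]
    simp
  have hcont : (outToAut A E).map (MulAut.congr e.toMulEquiv).toMonoidHom ≤ contMulAut B :=
    (Subgroup.map_mono (outToAut_le_contMulAut E)).trans (map_congr_contMulAut_le e)
  conv_rhs => rw [← outToAut_autToOut hinn hcont]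
  rw [h1]

end TransportDictionary

end Literature.AnabelianGeometry.EtaleTheta
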